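import Summits.ResolutionOfSingularities.ResolutionOfSingularities.Theorems.WeightedInvariantHypersurfaceLocalGameEFT4SDimLETwoOpenMonomialShrink
import Summits.ResolutionOfSingularities.ResolutionOfSingularities.Theorems.WeightedInvariantIotaOrderStratDimTwo
import Summits.ResolutionOfSingularities.ResolutionOfSingularities.Theorems.WeightedInvariantHypersurfaceLocalGameEFTCurveMoveChart
import Summits.ResolutionOfSingularities.ResolutionOfSingularities.Theorems.EquisingularLiftEquisingularLiftNatPlaneCurveSingular
import HarnessLib

/-!
# (open″)↾≤2 at monomial-type positions II: the ∀-model stratum-exact presentation along the curve `V(g)`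
# (rung P2, ORDER (o24-O), monomial-type half)

Topic: `Summits/ResolutionOfSingularities/ResolutionOfSingularities/Theorems`. Helper (part 2 of 2) for the conjunct
`JOpenPresentationForallSingLE2 p iotaOrd jContact` of the P2 rung statement `…HypersurfaceLocalGameEFT4SDimLETwo`
(res-type-073, p512950) of the door item `HypersurfaceCentreConstruction` (statement `stmt-ResolutionOfSingularities-19897`,
route `WeightedInvariant`), line `local-engine` of `res-L1-w43-plan-1`, ORDER (o24-O) (lead res-type-005, case assembly
`…EFT4SDimLETwoOpen.lean`; second hand res-type-025 = this MONOMIAL-TYPE half, plan-1 08:16:45Z / 08:18:00Z).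

[OURS · L1 W4.3] Replaces the role of NO printed item; NOT a statement of the manuscript
[claim: Hironaka2017, status: under-review]. AI work, weaker than expert review.

## Statement (ANY Krull dimension; `J` abstract through the one property res-type-092's `jContact_of_eq_unit_mul_pow` gives)

`jOpenPresentationForallSing_body_of_monomialType`: let `ι = iotaOrd` and let `J` satisfy
`J R (v·g^ν) m = (g)^m` for every regular local `R`, unit `v`, regular parameter `g ∈ 𝔪 ∖ 𝔪²`, `ν ≥ 1` (hypothesis `hJ`;
= `jContact_of_eq_unit_mul_pow` of ORDER (o24-D)). Let `A` be of finite type over a perfect field, `𝔪` a prime with `A_𝔪`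
regular, `F ∈ A` with `0 ≠ F/1 ∈ 𝔪² A_𝔪`, and suppose the position `(A_𝔪, F)` is of MONOMIAL TYPE: `F/1 = v·γ^ν` with
`v` a unit and `γ ∈ 𝔪A_𝔪 ∖ 𝔪²A_𝔪`. Then the body of (open″) holds with `N = 1`, `U = (g)`, `W = (1)` for a numerator `g ∈ A`
of `γ` and a basic open `D(h) ∋ 𝔪` on which: `A_𝔮` is regular (regular locus, perfect ground field), `g/1 ≠ 0` in `A_𝔮`
(support), `A_𝔮/(g)` is regular for `𝔮 ∋ g` (regular locus of `A/(g)`) — so `g` is a regular PARAMETER at every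
`𝔮 ∈ V(g) ∩ D(h)` — and `F = unit · g^ν`. Hence for `𝔮 ∈ D(h)`: `g ∈ 𝔮 ↔ (F ∈ 𝔪_𝔮² ∧ ord_𝔮 F = ν = ord_𝔪 F)` (off `V(g)`
the element `F` is a unit), and at `𝔮 ∋ g`: `J(A_𝔮, F, m) = (g)^m A_𝔮 = (weightedMonomialIdeal (g) (1) m)·A_𝔮`.  The
clause's bound `ringKrullDim A_𝔮 ≤ 2` is not used.  `jOpenPresentationForallSingLE2_of_monomialType` restates it with
the exact binders of the conjunct (for res-type-005's case assembly).

## References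

* H. Matsumura, *Commutative Ring Theory*, Thm. 14.2, §30 Cor. to Thm. 30.5. [Matsumura1987]
-/

noncomputable section

open IsLocalRing Literature.AlgebraicGeometry.Resolution
open Summit.ResolutionOfSingularities.ResolutionOfSingularities.Cruxes.HypersurfaceCentreConstruction.LocalEngine

set_option linter.dupNamespace false -- mandated namespace of this single-conjunct summit

namespace Summit.ResolutionOfSingularities.ResolutionOfSingularities.Theorems

namespace LocalGameEFTOpenMonomial

/-- `F = unit · g^ν` in the local ring at `𝔮` from an identity `d·(F t) = d·(b g^ν)` in `A` with `d, t, b ∉ 𝔮`. [folklore] -/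
theorem exists_unit_mul_pow_of_eq {A : Type} [CommRing A] {F g b t d : A} {ν : ℕ} (h : d * (F * t) = d * (b * g ^ ν))
    (𝔮 : Ideal A) [𝔮.IsPrime] (hd : d ∉ 𝔮) (ht : t ∉ 𝔮) (hb : b ∉ 𝔮) :
    ∃ w : Localization.AtPrime 𝔮, IsUnit w ∧
      algebraMap A (Localization.AtPrime 𝔮) F = w * algebraMap A (Localization.AtPrime 𝔮) g ^ ν := by
  have hu : ∀ y : A, y ∉ 𝔮 → IsUnit (algebraMap A (Localization.AtPrime 𝔮) y) := fun y hy =>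
    IsLocalization.map_units (Localization.AtPrime 𝔮) (⟨y, hy⟩ : 𝔮.primeCompl)
  have h' := congrArg (algebraMap A (Localization.AtPrime 𝔮)) h
  simp only [map_mul, map_pow] at h'
  have h'' := (hu d hd).mul_left_cancel h'
  refine ⟨algebraMap A _ b * ↑(hu t ht).unit⁻¹, (hu b hb).mul (Units.isUnit _), ?_⟩
  calc algebraMap A (Localization.AtPrime 𝔮) F
      = algebraMap A _ F * algebraMap A _ t * ↑(hu t ht).unit⁻¹ := by
        rw [mul_assoc, IsUnit.mul_val_inv, mul_one]
    _ = algebraMap A _ b * algebraMap A _ g ^ ν * ↑(hu t ht).unit⁻¹ := by rw [h'']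
    _ = algebraMap A _ b * ↑(hu t ht).unit⁻¹ * algebraMap A _ g ^ ν := by ring

/-- **(open″) at a MONOMIAL-TYPE position, for `ι = iotaOrd` and any `J` presented by `(g)^m` on monomial-type elements**
(see the module docstring). [OURS · L1 W4.3 · (o24-O) monomial-type half] [cite: Matsumura1987, Thm. 14.2] -/
theorem jOpenPresentationForallSing_body_of_monomialType
    (J : (R : Type) → [CommRing R] → R → ℕ → Ideal R)
    (hJ : ∀ (R : Type) [CommRing R] [IsRegularLocalRing R] (v g : R) (ν : ℕ), IsUnit v → g ∈ maximalIdeal R →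
      g ∉ maximalIdeal R ^ 2 → 1 ≤ ν → ∀ m : ℕ, J R (v * g ^ ν) m = Ideal.span {g} ^ m)
    (k₀ : Type) [Field k₀] [PerfectField k₀]
    (A : Type) [CommRing A] [Algebra k₀ A] [Algebra.FiniteType k₀ A] (𝔪 : Ideal A) [𝔪.IsPrime] (F : A)
    (hreg : IsRegularLocalRing (Localization.AtPrime 𝔪))
    (hF2 : algebraMap A (Localization.AtPrime 𝔪) F ∈ (maximalIdeal (Localization.AtPrime 𝔪)) ^ 2)
    (hmono : ∃ (v γ : Localization.AtPrime 𝔪) (ν : ℕ), IsUnit v ∧ γ ∈ maximalIdeal (Localization.AtPrime 𝔪) ∧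
      γ ∉ (maximalIdeal (Localization.AtPrime 𝔪)) ^ 2 ∧ algebraMap A (Localization.AtPrime 𝔪) F = v * γ ^ ν) :
    ∃ h : A, h ∉ 𝔪 ∧ ∃ (N : ℕ) (U : Fin N → A) (W : Fin N → ℕ), (∀ i, 0 < W i) ∧
      (∃ hU : ∀ i, algebraMap A (Localization.AtPrime 𝔪) (U i) ∈ maximalIdeal (Localization.AtPrime 𝔪),
        LinearIndependent (ResidueField (Localization.AtPrime 𝔪))
          (fun i => ((maximalIdeal (Localization.AtPrime 𝔪)).toCotangent ⟨_, hU i⟩ :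
            CotangentSpace (Localization.AtPrime 𝔪)))) ∧
      ∀ (𝔮 : Ideal A) [𝔮.IsPrime], h ∉ 𝔮 → ringKrullDim (Localization.AtPrime 𝔮) ≤ 2 →
        ((∀ i, U i ∈ 𝔮) ↔
          (algebraMap A (Localization.AtPrime 𝔮) F ∈ (maximalIdeal (Localization.AtPrime 𝔮)) ^ 2 ∧
            iotaOrd (Localization.AtPrime 𝔮) (algebraMap A (Localization.AtPrime 𝔮) F) =
              iotaOrd (Localization.AtPrime 𝔪) (algebraMap A (Localization.AtPrime 𝔪) F))) ∧
        ((∀ i, U i ∈ 𝔮) → ∀ m : ℕ,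
          J (Localization.AtPrime 𝔮) (algebraMap A (Localization.AtPrime 𝔮) F) m =
            (weightedMonomialIdeal U W m).map (algebraMap A (Localization.AtPrime 𝔮))) := by
  classical
  haveI := hreg
  haveI : IsNoetherianRing A := Algebra.FiniteType.isNoetherianRing k₀ A
  haveI := isDomain_of_isRegularLocalRing (Localization.AtPrime 𝔪)
  obtain ⟨v, γ, ν, hv, hγ, hγ2, hFv⟩ := hmono
  -- a numerator `g ∈ A` of `γ`: `γ · s/1 = g/1`
  obtain ⟨⟨g, s⟩, hgs⟩ := IsLocalization.surj 𝔪.primeCompl γ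
  have hsu : IsUnit (algebraMap A (Localization.AtPrime 𝔪) (s : A)) :=
    IsLocalization.map_units (Localization.AtPrime 𝔪) s
  have hgγ : algebraMap A (Localization.AtPrime 𝔪) g = γ * algebraMap A (Localization.AtPrime 𝔪) (s : A) := hgs.symm
  have hgm : algebraMap A (Localization.AtPrime 𝔪) g ∈ maximalIdeal (Localization.AtPrime 𝔪) := by
    rw [hgγ]; exact Ideal.mul_mem_right _ _ hγ
  have hgm2 : algebraMap A (Localization.AtPrime 𝔪) g ∉ (maximalIdeal (Localization.AtPrime 𝔪)) ^ 2 := by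
    rw [hgγ, mul_comm, Ideal.unit_mul_mem_iff_mem _ hsu]; exact hγ2
  have hg𝔪 : g ∈ 𝔪 := (IsLocalization.AtPrime.to_map_mem_maximal_iff (Localization.AtPrime 𝔪) 𝔪 g).mp hgm
  have hg0 : algebraMap A (Localization.AtPrime 𝔪) g ≠ 0 := fun h => hgm2 (h ▸ Ideal.zero_mem _)
  -- `F/1 = w · (g/1)^ν` with `w` a unit
  set w : Localization.AtPrime 𝔪 := v * ↑(hsu.unit⁻¹ ^ ν) with hwdef
  have hw : IsUnit w := hv.mul (Units.isUnit _)
  have hFw : algebraMap A (Localization.AtPrime 𝔪) F = w * algebraMap A (Localization.AtPrime 𝔪) g ^ ν := by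
    have hone : ((hsu.unit⁻¹ ^ ν : (Localization.AtPrime 𝔪)ˣ) : Localization.AtPrime 𝔪) *
        algebraMap A (Localization.AtPrime 𝔪) (s : A) ^ ν = 1 := by
      rw [Units.val_pow_eq_pow_val, ← mul_pow, IsUnit.val_inv_mul, one_pow]
    calc algebraMap A (Localization.AtPrime 𝔪) F = v * γ ^ ν := hFv
      _ = v * γ ^ ν * (((hsu.unit⁻¹ ^ ν : (Localization.AtPrime 𝔪)ˣ) : Localization.AtPrime 𝔪) *
            algebraMap A (Localization.AtPrime 𝔪) (s : A) ^ ν) := by rw [hone, mul_one]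
      _ = w * algebraMap A (Localization.AtPrime 𝔪) g ^ ν := by rw [hwdef, hgγ, mul_pow]; ring
  have hν2 : 2 ≤ ν := IotaOrderStrat.two_le_of_eq_unit_mul_pow_of_mem_sq hw hgm hgm2 hFw hF2
  have hord𝔪 : iotaOrd (Localization.AtPrime 𝔪) (algebraMap A (Localization.AtPrime 𝔪) F) = ν := by
    rw [hFw]; exact IotaOrderStrat.iotaOrd_unit_mul_pow hw hgm hgm2 ν
  -- clear the denominators of `w`: `d · (F t) = d · (b g^ν)` in `A` with `d, t, b ∉ 𝔪`
  obtain ⟨⟨b, t⟩, hbt⟩ := IsLocalization.surj 𝔪.primeCompl w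
  have hbm : b ∉ 𝔪 := by
    intro hb
    have hbS : algebraMap A (Localization.AtPrime 𝔪) b ∈ maximalIdeal (Localization.AtPrime 𝔪) :=
      (IsLocalization.AtPrime.to_map_mem_maximal_iff (Localization.AtPrime 𝔪) 𝔪 b).mpr hb
    have hbu : IsUnit (algebraMap A (Localization.AtPrime 𝔪) b) := by
      rw [← hbt]; exact hw.mul (IsLocalization.map_units (Localization.AtPrime 𝔪) t)
    exact (mem_nonunits_iff.mp ((IsLocalRing.mem_maximalIdeal _).mp hbS)) hbu
  have heqF : algebraMap A (Localization.AtPrime 𝔪) (F * t) = algebraMap A (Localization.AtPrime 𝔪) (b * g ^ ν) := by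
    rw [map_mul, map_mul, map_pow, hFw, ← hbt]; ring
  obtain ⟨d, hd⟩ := IsLocalization.exists_of_eq (M := 𝔪.primeCompl) heqF
  -- the three shrinkings
  obtain ⟨hr, hhr, Hreg⟩ := exists_not_mem_forall_isRegularLocalRing k₀ A 𝔪 hreg
  obtain ⟨hs', hhs', Hsupp⟩ := exists_not_mem_forall_algebraMap_ne_zero 𝔪 hg0
  haveI h𝔪' := map_mk_isPrime g 𝔪 hg𝔪
  have hreg' : IsRegularLocalRing (Localization.AtPrime (𝔪.map (Ideal.Quotient.mk (Ideal.span {g})))) :=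
    (isRegularLocalRing_quotient_iff g 𝔪 hg𝔪).mp (IsRegularLocalRing.quotient_span_singleton hgm hgm2).1
  obtain ⟨hq', hhq', Hq⟩ := exists_not_mem_forall_isRegularLocalRing k₀ (A ⧸ Ideal.span {g})
    (𝔪.map (Ideal.Quotient.mk (Ideal.span {g}))) hreg'
  obtain ⟨hq, rfl⟩ := Ideal.Quotient.mk_surjective hq'
  have hhq : hq ∉ 𝔪 := fun h => hhq' (Ideal.mem_map_of_mem _ h)
  -- at a prime `𝔮 ∋ g` of the open: `g/1` is a regular parameter of the regular local ring `A_𝔮`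
  have key : ∀ (𝔮 : Ideal A) [𝔮.IsPrime], hr ∉ 𝔮 → hs' ∉ 𝔮 → hq ∉ 𝔮 → g ∈ 𝔮 →
      IsRegularLocalRing (Localization.AtPrime 𝔮) ∧
        algebraMap A (Localization.AtPrime 𝔮) g ∈ maximalIdeal (Localization.AtPrime 𝔮) ∧
        algebraMap A (Localization.AtPrime 𝔮) g ∉ (maximalIdeal (Localization.AtPrime 𝔮)) ^ 2 := by
    intro 𝔮 _ hr𝔮 hs𝔮 hq𝔮 hg𝔮
    haveI hreg𝔮 : IsRegularLocalRing (Localization.AtPrime 𝔮) := Hreg 𝔮 hr𝔮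
    haveI := isDomain_of_isRegularLocalRing (Localization.AtPrime 𝔮)
    have hgq : algebraMap A (Localization.AtPrime 𝔮) g ∈ maximalIdeal (Localization.AtPrime 𝔮) :=
      (IsLocalization.AtPrime.to_map_mem_maximal_iff (Localization.AtPrime 𝔮) 𝔮 g).mpr hg𝔮
    haveI := map_mk_isPrime g 𝔮 hg𝔮
    have hqbar : Ideal.Quotient.mk (Ideal.span {g}) hq ∉ 𝔮.map (Ideal.Quotient.mk (Ideal.span {g})) := by
      intro hmem
      rw [← Ideal.mem_comap, Ideal.comap_map_of_surjective _ Ideal.Quotient.mk_surjective,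
        ← RingHom.ker_eq_comap_bot, Ideal.mk_ker,
        sup_eq_left.mpr ((Ideal.span_singleton_le_iff_mem _).mpr hg𝔮)] at hmem
      exact hq𝔮 hmem
    have hregq := (isRegularLocalRing_quotient_iff g 𝔮 hg𝔮).mpr (Hq _ hqbar)
    refine ⟨hreg𝔮, hgq, ?_⟩
    refine Summit.ResolutionOfSingularities.ResolutionOfSingularities.Cruxes.EquisingularLiftNat.Sections.not_mem_sq_of_isRegularLocalRing_quotient
      hgq ?_ hregq
    exact Module.Flat.isSMulRegular_of_nonZeroDivisors (mem_nonZeroDivisors_of_ne_zero (Hsupp 𝔮 hs𝔮))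
  -- the data: `D(d t b · hr hs hq)`, `U = (g)`, `W = (1)`
  refine ⟨(d : A) * t * b * (hr * hs' * hq), fun hmem => ?_, 1, fun _ => g, fun _ => 1, fun _ => Nat.one_pos,
    ⟨fun _ => hgm, ?_⟩, ?_⟩
  · rcases (‹𝔪.IsPrime›).mem_or_mem hmem with h | h
    · rcases (‹𝔪.IsPrime›).mem_or_mem h with h | h
      · rcases (‹𝔪.IsPrime›).mem_or_mem h with h | h
        · exact d.2 h
        · exact t.2 h
      · exact hbm h
    · rcases (‹𝔪.IsPrime›).mem_or_mem h with h | h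
      · rcases (‹𝔪.IsPrime›).mem_or_mem h with h | h
        · exact hhr h
        · exact hhs' h
      · exact hhq h
  · -- the cotangent image of `g` is non-zero
    rw [linearIndependent_unique_iff, Ne, Ideal.toCotangent_eq_zero]
    exact hgm2
  · intro 𝔮 _ hh𝔮 _
    have hnot : ∀ x : A, x ∣ (d : A) * t * b * (hr * hs' * hq) → x ∉ 𝔮 := by
      rintro x ⟨c, hc⟩ hx
      exact hh𝔮 (hc ▸ Ideal.mul_mem_right c 𝔮 hx)
    have hd𝔮 := hnot d ⟨t * b * (hr * hs' * hq), by ring⟩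
    have ht𝔮 := hnot t ⟨d * b * (hr * hs' * hq), by ring⟩
    have hb𝔮 := hnot b ⟨d * t * (hr * hs' * hq), by ring⟩
    have hr𝔮 := hnot hr ⟨d * t * b * (hs' * hq), by ring⟩
    have hs𝔮 := hnot hs' ⟨d * t * b * (hr * hq), by ring⟩
    have hq𝔮 := hnot hq ⟨d * t * b * (hr * hs'), by ring⟩
    obtain ⟨w', hw', hFw'⟩ := exists_unit_mul_pow_of_eq hd 𝔮 hd𝔮 ht𝔮 hb𝔮
    refine ⟨⟨fun hU => ?_, fun hrhs => ?_⟩, fun hU m => ?_⟩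
    · -- `g ∈ 𝔮`: singular point of order exactly `ν`
      obtain ⟨hreg𝔮, hgq, hgq2⟩ := key 𝔮 hr𝔮 hs𝔮 hq𝔮 (hU 0)
      haveI := hreg𝔮
      refine ⟨?_, ?_⟩
      · rw [hFw']
        exact Ideal.mul_mem_left _ _ (Ideal.pow_le_pow_right hν2 (Ideal.pow_mem_pow hgq ν))
      · rw [hFw', IotaOrderStrat.iotaOrd_unit_mul_pow hw' hgq hgq2 ν, hord𝔪]
    · -- off `V(g)` the element `F` is a unit
      intro _
      by_contra hg𝔮
      have hgu : IsUnit (algebraMap A (Localization.AtPrime 𝔮) g) :=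
        IsLocalization.map_units (Localization.AtPrime 𝔮) (⟨g, hg𝔮⟩ : 𝔮.primeCompl)
      have hFu : IsUnit (algebraMap A (Localization.AtPrime 𝔮) F) := by
        rw [hFw']; exact hw'.mul (hgu.pow ν)
      have hmem : algebraMap A (Localization.AtPrime 𝔮) F ∈ maximalIdeal (Localization.AtPrime 𝔮) :=
        Ideal.pow_le_self two_ne_zero hrhs.1
      exact (mem_nonunits_iff.mp ((IsLocalRing.mem_maximalIdeal _).mp hmem)) hFu
    · -- presentation along `V(g)`
      obtain ⟨hreg𝔮, hgq, hgq2⟩ := key 𝔮 hr𝔮 hs𝔮 hq𝔮 (hU 0)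
      haveI := hreg𝔮
      rw [hFw', hJ (Localization.AtPrime 𝔮) w' _ ν hw' hgq hgq2 (by omega) m,
        LocalGameEFTCurveMove.weightedMonomialIdeal_one_eq, Ideal.map_span, Set.image_singleton, map_pow,
        Ideal.span_singleton_pow]

end LocalGameEFTOpenMonomial

end Summit.ResolutionOfSingularities.ResolutionOfSingularities.Theorems

end
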